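import Literature.NumberTheory.EllipticCurves.IntSeriesIdentityPrinciple
import Literature.NumberTheory.EllipticCurves.IntSeriesFwdDiffCertificate
import Literature.NumberTheory.GaloisRepresentations.LAdicCharacterUnramifiedAEProofs
import HarnessLib

set_option autoImplicit false

/-!
# Norm rigidity of the values of a bounded `p`-adic power series along a geometric progression of
# nodes: two integral series whose values at `uᵗ − 1` are proportional by `c·dᵗ` have `‖d‖ = 1`

Topic `NumberTheory/EllipticCurves` (receptacle `𝒪_{ℂ_p}⟦T⟧`, values `IntSeries.HasValueAt`; companion
of `IntSeriesIdentityPrinciple`, `IntSeriesFwdDiffCertificate`, `IntSeriesTwoPointCertificate`).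

WHY.  Two typed two-variable Katz–de Shalit frames of the same datum `(ι, v, v̄, S, ψ, pair)` with
different period triples `(Ω, δ, Ω_p)`, `(Ω', δ', Ω_p')` prescribe, at the type-`(−m, 0)` interpolation
characters `ψ⁻¹Ψ^{−Mt}` (`m = a + wMt`) of ONE `ℤ_p`-line, values that are EXACTLY proportional:
`x'_t = c^{a + wMt} · x_t` with `c = ι⁻¹(Ω/Ω')·Ω_p'/Ω_p ∈ ℂ_p^×` (the interpolation value is `(Ω^m)⁻¹`
times a period-free quantity).  Both branches are integral power series read at the same nodes
`uᵗ − 1`.  This file proves that then `‖c‖ = 1` as soon as ONE value is non-zero — so the NORMS of the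
frame values on a line are invariants of the datum, not of the periods: a numerical certificate stated
through value norms (e.g. `IntSeries.isUnit_coeff_two_of_nodeValues`) holds in every typed frame as
soon as it holds in one.  (Written for hypothesis `H` of the negative-modulo booking of crux
`CycTangentCM.CycTangentBound`, stmt-BirchSwinnertonDyer-22628, which is quantified over ALL frames.)

* `norm_value_sub_value_le` — evaluation of `F ∈ 𝒪_{ℂ_p}⟦T⟧` is `1`-Lipschitz on the closed unit disc.
* `norm_value_le_one` — values have norm `≤ 1`.
* `norm_pow_prime_pow_sub_one_le` — for a one-unit `u`: `‖u^{p^k} − 1‖ ≤ θ^k ‖u − 1‖`,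
  `θ = max(‖p‖, ‖u − 1‖) < 1`.
* `eq_zero_of_norm_values_le_geometric` — if the values `x_t = F(uᵗ − 1)` (`u` a one-unit, no `uⁿ = 1`)
  decay geometrically, `‖x_t‖ ≤ A rᵗ` with `r < 1`, then `F = 0`: `x_s = lim_k x_{s + p^k} = 0` for every
  `s` (Lipschitz + `u^{p^k} → 1`), and the nodes are infinitely many points of the closed disc
  `‖x‖ ≤ ‖u − 1‖` (identity principle `eq_zero_of_infinite_zeros`).
* `norm_eq_one_of_values_proportional` — **THE RIGIDITY**: `F'(uᵗ − 1) = c·dᵗ·F(uᵗ − 1)` for all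
  `t ∈ ℕ`, `c, d ≠ 0`, some `F(u^{t₀} − 1) ≠ 0` ⟹ `‖d‖ = 1` (if `‖d‖ > 1` the values of `F` decay
  geometrically, if `‖d‖ < 1` those of `F'` do); `norm_eq_one_of_values_proportional_pow` — the frame
  shape `x'_t = c^{a + bt} x_t`, `b > 0` ⟹ `‖c‖ = 1`; `norm_values_eq_of_proportional_pow` — hence
  `‖x'_t‖ = ‖x_t‖` for all `t`.
* `forall_pow_ne_one_of_norm_sub_one_lt` — the node hypothesis from the frames' `u ≠ 1`,
  `‖u − 1‖ < ‖p‖` (no root of unity among the one-units of level `|p|`, read in `ℂ_p`).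

THEOREMS ONLY (no definition, no named fact, no `sorry`).
References: F. Gouvêa, *p-adic Numbers*, §5.6 (Strassman, identity theorem on closed discs);
L. Washington, *Introduction to Cyclotomic Fields*, §5.2 (values of Iwasawa power series at `uᵗ − 1`).
-/

noncomputable section

open scoped Classical
open Filter Topology PowerSeries

namespace Literature.NumberTheory.EllipticCurves.IntSeries

variable {p : ℕ} [Fact p.Prime]

/-! ### §1. Evaluation is `1`-Lipschitz and bounded by `1` -/

/-- **Evaluation of `F ∈ 𝒪_{ℂ_p}⟦T⟧` is `1`-Lipschitz on the closed unit disc**: if `F(a) = v`, `F(b) = w`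
with `‖a‖, ‖b‖ ≤ 1` then `‖v − w‖ ≤ ‖a − b‖` (`v − w = Σ c_n (aⁿ − bⁿ)`, `‖aⁿ − bⁿ‖ ≤ ‖a − b‖`).
[cite: Gouvea1993PadicNumbers, §5.6 (Cor. 5.6.3, proof)] -/
theorem norm_value_sub_value_le {F : PowerSeries (PadicComplexInt p)} {a b v w : ℂ_[p]}
    (ha : ‖a‖ ≤ 1) (hb : ‖b‖ ≤ 1) (hv : IntSeries.HasValueAt F a v) (hw : IntSeries.HasValueAt F b w) :
    ‖v - w‖ ≤ ‖a - b‖ := by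
  have hs : HasSum (fun n : ℕ ↦
      ((PowerSeries.coeff n F : PadicComplexInt p) : ℂ_[p]) * (a ^ n - b ^ n)) (v - w) := by
    have h := HasSum.sub hv hw
    refine h.congr_fun fun n ↦ ?_
    ring
  rw [← hs.tsum_eq]
  refine IsUltrametricDist.norm_tsum_le_of_forall_le_of_nonneg (norm_nonneg _) fun n ↦ ?_
  cases n with
  | zero => simp
  | succ k =>
    rw [norm_mul]
    calc ‖((PowerSeries.coeff (k + 1) F : PadicComplexInt p) : ℂ_[p])‖ * ‖a ^ (k + 1) - b ^ (k + 1)‖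
        ≤ 1 * (‖a - b‖ * 1 ^ k) :=
          mul_le_mul (norm_coe_padicComplexInt_le_one _) (norm_pow_sub_pow_le ha hb k)
            (norm_nonneg _) zero_le_one
      _ = ‖a - b‖ := by rw [one_pow, mul_one, one_mul]

/-- Values of `F ∈ 𝒪_{ℂ_p}⟦T⟧` at points of the closed unit disc have norm `≤ 1`.
[cite: Gouvea1993PadicNumbers, §5.6] -/
theorem norm_value_le_one {F : PowerSeries (PadicComplexInt p)} {a v : ℂ_[p]} (ha : ‖a‖ ≤ 1)
    (hv : IntSeries.HasValueAt F a v) : ‖v‖ ≤ 1 := by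
  rw [← hv.tsum_eq]
  refine IsUltrametricDist.norm_tsum_le_of_forall_le_of_nonneg zero_le_one fun n ↦ ?_
  rw [norm_mul, norm_pow]
  exact mul_le_one₀ (norm_coe_padicComplexInt_le_one _) (pow_nonneg (norm_nonneg _) _)
    (pow_le_one₀ (norm_nonneg _) ha)

/-- The zero series has only the value `0`. [cite: Gouvea1993PadicNumbers, §5.6] -/
theorem eq_zero_of_hasValueAt_zero_series {a v : ℂ_[p]}
    (hv : IntSeries.HasValueAt (0 : PowerSeries (PadicComplexInt p)) a v) : v = 0 := by
  have h0 : IntSeries.HasValueAt (0 : PowerSeries (PadicComplexInt p)) a 0 := by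
    unfold IntSeries.HasValueAt
    have : (fun k : ℕ ↦ ((PowerSeries.coeff k (0 : PowerSeries (PadicComplexInt p)) :
        PadicComplexInt p) : ℂ_[p]) * a ^ k) = fun _ ↦ 0 := by
      funext k; simp
    rw [this]
    exact hasSum_zero
  exact hv.unique h0

/-! ### §2. Powers of a one-unit along `p^k` -/

/-- `‖uᵐ − 1‖ ≤ ‖u − 1‖` for a one-unit `u` (`uᵐ − 1 = (u − 1)·Σ_{j<m} uʲ`); private twin of the
tree's `R1.norm_pow_sub_one_le` (Summits side, not importable here). [folklore] -/
private theorem norm_pow_sub_one_le_norm_sub_one {u : ℂ_[p]} (hu : ‖u - 1‖ < 1) (m : ℕ) :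
    ‖u ^ m - 1‖ ≤ ‖u - 1‖ := by
  have hu1 : ‖u‖ = 1 := Literature.NumberTheory.GaloisRepresentations.norm_eq_one_of_norm_sub_one_lt_one hu
  rw [← geom_sum_mul, norm_mul]
  refine mul_le_of_le_one_left (norm_nonneg _) ?_
  refine IsUltrametricDist.norm_sum_le_of_forall_le_of_nonneg zero_le_one fun i _ ↦ ?_
  rw [norm_pow, hu1, one_pow]

/-- **One `p`-th power contracts a one-unit towards `1`**: `‖uᵖ − 1‖ ≤ max(‖p‖, ‖u − 1‖) · ‖u − 1‖`
(`uᵖ − 1 = (u − 1)·Σ_{j<p} uʲ` and `Σ_{j<p} uʲ ≡ p` modulo terms of norm `≤ ‖u − 1‖`).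
[cite: Gouvea1993PadicNumbers, §5.6] -/
theorem norm_pow_prime_sub_one_le {u : ℂ_[p]} (hu : ‖u - 1‖ < 1) :
    ‖u ^ p - 1‖ ≤ max ‖(p : ℂ_[p])‖ ‖u - 1‖ * ‖u - 1‖ := by
  have hgeom := Literature.NumberTheory.GaloisRepresentations.norm_geom_sum_sub_natCast_le hu p
  have hS : ‖∑ j ∈ Finset.range p, u ^ j‖ ≤ max ‖(p : ℂ_[p])‖ ‖u - 1‖ := by
    have hsplit : ∑ j ∈ Finset.range p, u ^ j = (p : ℂ_[p]) + ((∑ j ∈ Finset.range p, u ^ j) - p) := by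
      ring
    rw [hsplit]
    exact (IsUltrametricDist.norm_add_le_max _ _).trans (max_le_max le_rfl hgeom)
  rw [← geom_sum_mul, norm_mul]
  exact mul_le_mul_of_nonneg_right hS (norm_nonneg _)

/-- `‖p‖ < 1` in `ℂ_p`; private twin of `norm_prime_padicComplex_lt_one`
(`PAdicLFunctionInterpolationProofs`, heavy import avoided). [folklore] -/
private theorem norm_natCast_prime_lt_one : ‖(p : ℂ_[p])‖ < 1 := by
  rw [← PadicComplex.coe_natCast p p, PadicComplex.norm_extends p]
  exact Literature.NumberTheory.GaloisRepresentations.PadicAlgCl.norm_natCast_self_lt_one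

/-- **Iterated: `‖u^{p^k} − 1‖ ≤ θ^k · ‖u − 1‖` with `θ = max(‖p‖, ‖u − 1‖)`** — so `u^{p^k} → 1`
geometrically for a one-unit `u`. [cite: Gouvea1993PadicNumbers, §5.6] -/
theorem norm_pow_prime_pow_sub_one_le {u : ℂ_[p]} (hu : ‖u - 1‖ < 1) (k : ℕ) :
    ‖u ^ p ^ k - 1‖ ≤ (max ‖(p : ℂ_[p])‖ ‖u - 1‖) ^ k * ‖u - 1‖ := by
  set θ : ℝ := max ‖(p : ℂ_[p])‖ ‖u - 1‖ with hθ
  have hθ0 : 0 ≤ θ := le_max_of_le_right (norm_nonneg _)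
  have hθ1 : θ ≤ 1 := max_le norm_natCast_prime_lt_one.le hu.le
  induction k with
  | zero => simp
  | succ k ih =>
    -- `z = u^{p^k}` is again a one-unit, at least as close to `1` as `u`
    have hzle : ‖u ^ p ^ k - 1‖ ≤ ‖u - 1‖ := by
      refine ih.trans ?_
      calc θ ^ k * ‖u - 1‖ ≤ 1 * ‖u - 1‖ :=
            mul_le_mul_of_nonneg_right (pow_le_one₀ hθ0 hθ1) (norm_nonneg _)
        _ = ‖u - 1‖ := one_mul _
    have hz : ‖u ^ p ^ k - 1‖ < 1 := lt_of_le_of_lt hzle hu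
    have hstep := norm_pow_prime_sub_one_le hz
    have hmax : max ‖(p : ℂ_[p])‖ ‖u ^ p ^ k - 1‖ ≤ θ := max_le_max le_rfl hzle
    rw [pow_succ, pow_mul]
    calc ‖(u ^ p ^ k) ^ p - 1‖ ≤ max ‖(p : ℂ_[p])‖ ‖u ^ p ^ k - 1‖ * ‖u ^ p ^ k - 1‖ := hstep
      _ ≤ θ * (θ ^ k * ‖u - 1‖) := mul_le_mul hmax ih (norm_nonneg _) hθ0
      _ = θ ^ k * θ * ‖u - 1‖ := by ring

/-! ### §3. Geometric decay of the values along the nodes forces the series to vanish -/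

/-- **Geometric decay of the values `F(uᵗ − 1)` forces `F = 0`.**  Let `u` be a one-unit of `ℂ_p` that
is not a root of unity, `F ∈ 𝒪_{ℂ_p}⟦T⟧` with values `x_t = F(uᵗ − 1)` for all `t ∈ ℕ`, and suppose
`‖x_t‖ ≤ A · rᵗ` with `0 ≤ r < 1`.  Then `F = 0`: for each `s`, `x_s = lim_k x_{s + p^k}` (`1`-Lipschitz
evaluation and `u^{p^k} → 1`) while `x_{s + p^k} → 0`, so every node `uˢ − 1` is a zero of `F`; the nodes
are pairwise distinct points of the closed disc `‖x‖ ≤ ‖u − 1‖ < 1`, so the identity principle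
(`eq_zero_of_infinite_zeros`) applies. [cite: Gouvea1993PadicNumbers, §5.6 (Cor. 5.6.3–5.6.4)] -/
theorem eq_zero_of_norm_values_le_geometric {F : PowerSeries (PadicComplexInt p)} {u : ℂ_[p]}
    {x : ℕ → ℂ_[p]} (hu : ‖u - 1‖ < 1) (hroot : ∀ n : ℕ, 0 < n → u ^ n ≠ 1)
    (hx : ∀ t : ℕ, IntSeries.HasValueAt F (u ^ t - 1) (x t)) {A r : ℝ} (hr0 : 0 ≤ r) (hr1 : r < 1)
    (hA : ∀ t : ℕ, ‖x t‖ ≤ A * r ^ t) : F = 0 := by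
  have hu1 : ‖u‖ = 1 := Literature.NumberTheory.GaloisRepresentations.norm_eq_one_of_norm_sub_one_lt_one hu
  have hϖ0 : u - 1 ≠ 0 := by
    intro h
    exact hroot 1 one_pos (by rw [pow_one]; exact sub_eq_zero.mp h)
  set θ : ℝ := max ‖(p : ℂ_[p])‖ ‖u - 1‖ with hθ
  have hθ0 : 0 ≤ θ := le_max_of_le_right (norm_nonneg _)
  have hθ1 : θ < 1 := max_lt norm_natCast_prime_lt_one hu
  have hA0 : 0 ≤ A := by
    have h := hA 0
    rw [pow_zero, mul_one] at h
    exact (norm_nonneg _).trans h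
  -- every node value vanishes
  have hzero : ∀ s : ℕ, x s = 0 := by
    intro s
    -- the two bounds, both tending to `0` in `k`
    have hbound : ∀ k : ℕ, ‖x s‖ ≤ max (θ ^ k * ‖u - 1‖) (A * r ^ p ^ k) := by
      intro k
      have hlip : ‖x s - x (s + p ^ k)‖ ≤ θ ^ k * ‖u - 1‖ := by
        have h1 : ‖u ^ s - 1‖ ≤ 1 := (norm_pow_sub_one_le_norm_sub_one hu s).trans hu.le
        have h2 : ‖u ^ (s + p ^ k) - 1‖ ≤ 1 := (norm_pow_sub_one_le_norm_sub_one hu _).trans hu.le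
        refine (norm_value_sub_value_le h1 h2 (hx s) (hx (s + p ^ k))).trans ?_
        have hdiff : (u ^ s - 1) - (u ^ (s + p ^ k) - 1) = -(u ^ s * (u ^ p ^ k - 1)) := by ring
        rw [hdiff, norm_neg, norm_mul, norm_pow, hu1, one_pow, one_mul]
        exact norm_pow_prime_pow_sub_one_le hu k
      have hfar : ‖x (s + p ^ k)‖ ≤ A * r ^ p ^ k := by
        refine (hA (s + p ^ k)).trans ?_
        rw [pow_add]
        calc A * (r ^ s * r ^ p ^ k) ≤ A * (1 * r ^ p ^ k) := by
              refine mul_le_mul_of_nonneg_left ?_ hA0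
              exact mul_le_mul_of_nonneg_right (pow_le_one₀ hr0 hr1.le) (pow_nonneg hr0 _)
          _ = A * r ^ p ^ k := by rw [one_mul]
      have hsplit : x s = (x s - x (s + p ^ k)) + x (s + p ^ k) := by ring
      rw [hsplit]
      exact (IsUltrametricDist.norm_add_le_max _ _).trans (max_le_max hlip hfar)
    have htend : Tendsto (fun k : ℕ ↦ max (θ ^ k * ‖u - 1‖) (A * r ^ p ^ k)) atTop (𝓝 0) := by
      have h1 : Tendsto (fun k : ℕ ↦ θ ^ k * ‖u - 1‖) atTop (𝓝 0) := by
        have := (tendsto_pow_atTop_nhds_zero_of_lt_one hθ0 hθ1).mul_const ‖u - 1‖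
        rwa [zero_mul] at this
      have h2 : Tendsto (fun k : ℕ ↦ A * r ^ p ^ k) atTop (𝓝 0) := by
        have hpk : Tendsto (fun k : ℕ ↦ p ^ k) atTop atTop :=
          tendsto_pow_atTop_atTop_of_one_lt (Fact.out : p.Prime).one_lt
        have hr : Tendsto (fun k : ℕ ↦ r ^ p ^ k) atTop (𝓝 0) :=
          (tendsto_pow_atTop_nhds_zero_of_lt_one hr0 hr1).comp hpk
        have := hr.const_mul A
        rwa [mul_zero] at this
      have := h1.max h2
      rwa [max_self] at this
    have hle : ‖x s‖ ≤ 0 :=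
      le_of_tendsto_of_tendsto' tendsto_const_nhds htend hbound
    exact norm_le_zero_iff.mp hle
  -- the nodes are infinitely many zeros in the closed disc `‖·‖ ≤ ‖u − 1‖`
  have hu0 : u ≠ 0 := fun h0 ↦ by rw [h0, norm_zero] at hu1; exact zero_ne_one hu1
  have hkey : ∀ s n : ℕ, 0 < n → u ^ s ≠ u ^ (s + n) := by
    intro s n hn h
    refine hroot n hn (mul_left_cancel₀ (pow_ne_zero s hu0) ?_)
    rw [mul_one, ← pow_add]
    exact h.symm
  have hinj : Function.Injective fun s : ℕ ↦ u ^ s - 1 := by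
    intro s s' h
    have h' : u ^ s = u ^ s' := sub_left_injective h
    by_contra hne
    rcases Nat.lt_or_gt_of_ne hne with hlt | hlt
    · have h2 := hkey s (s' - s) (Nat.sub_pos_of_lt hlt)
      rw [Nat.add_sub_cancel' hlt.le] at h2
      exact h2 h'
    · have h2 := hkey s' (s - s') (Nat.sub_pos_of_lt hlt)
      rw [Nat.add_sub_cancel' hlt.le] at h2
      exact h2 h'.symm
  have hinf : {y : ℂ_[p] | ‖y‖ ≤ ‖u - 1‖ ∧ IntSeries.HasValueAt F y 0}.Infinite := by
    refine Set.infinite_of_injective_forall_mem hinj fun s ↦ ⟨?_, ?_⟩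
    · exact norm_pow_sub_one_le_norm_sub_one hu s
    · have h := hx s
      rwa [hzero s] at h
  exact eq_zero_of_infinite_zeros hϖ0 hu hinf

/-! ### §4. The rigidity: proportional values force a unimodular ratio -/

/-- **NORM RIGIDITY of values along a geometric progression of nodes.**  `F, F' ∈ 𝒪_{ℂ_p}⟦T⟧`, `u` a
one-unit that is not a root of unity, values `x_t = F(uᵗ − 1)`, `x'_t = F'(uᵗ − 1)` with
`x'_t = c · dᵗ · x_t` for all `t ∈ ℕ` (`c, d ≠ 0`), and ONE `x_{t₀} ≠ 0`: then `‖d‖ = 1`.  (If `‖d‖ > 1`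
then `‖x_t‖ ≤ ‖c⁻¹‖‖d‖^{−t}` decays geometrically and `F = 0`; if `‖d‖ < 1` then `‖x'_t‖ ≤ ‖c‖‖d‖ᵗ` and
`F' = 0`; either contradicts `x_{t₀} ≠ 0`.) [cite: Gouvea1993PadicNumbers, §5.6 (Cor. 5.6.3–5.6.4)] -/
theorem norm_eq_one_of_values_proportional {F F' : PowerSeries (PadicComplexInt p)} {u c d : ℂ_[p]}
    {x x' : ℕ → ℂ_[p]} (hu : ‖u - 1‖ < 1) (hroot : ∀ n : ℕ, 0 < n → u ^ n ≠ 1) (hc : c ≠ 0)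
    (hd : d ≠ 0) (hx : ∀ t : ℕ, IntSeries.HasValueAt F (u ^ t - 1) (x t))
    (hx' : ∀ t : ℕ, IntSeries.HasValueAt F' (u ^ t - 1) (x' t))
    (hrel : ∀ t : ℕ, x' t = c * d ^ t * x t) {t₀ : ℕ} (h0 : x t₀ ≠ 0) : ‖d‖ = 1 := by
  have hnode : ∀ t : ℕ, ‖u ^ t - 1‖ ≤ 1 := fun t ↦ (norm_pow_sub_one_le_norm_sub_one hu t).trans hu.le
  by_contra hne
  rcases lt_or_gt_of_ne hne with hlt | hgt
  · -- `‖d‖ < 1`: the values of `F'` decay, so `F' = 0`, so `x'_{t₀} = 0`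
    have hA : ∀ t : ℕ, ‖x' t‖ ≤ ‖c‖ * ‖d‖ ^ t := by
      intro t
      rw [hrel t, norm_mul, norm_mul, norm_pow]
      calc ‖c‖ * ‖d‖ ^ t * ‖x t‖ ≤ ‖c‖ * ‖d‖ ^ t * 1 :=
            mul_le_mul_of_nonneg_left (norm_value_le_one (hnode t) (hx t))
              (mul_nonneg (norm_nonneg _) (pow_nonneg (norm_nonneg _) _))
        _ = ‖c‖ * ‖d‖ ^ t := mul_one _
    have hF' : F' = 0 := eq_zero_of_norm_values_le_geometric hu hroot hx' (norm_nonneg d) hlt hA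
    have hx0 : x' t₀ = 0 := by
      have h := hx' t₀
      rw [hF'] at h
      exact eq_zero_of_hasValueAt_zero_series h
    rw [hrel t₀] at hx0
    rcases mul_eq_zero.mp hx0 with h1 | h1
    · rcases mul_eq_zero.mp h1 with h2 | h2
      · exact hc h2
      · exact hd (pow_eq_zero_iff (n := t₀) (by
          rintro rfl; rw [pow_zero] at h2; exact one_ne_zero h2) |>.mp h2)
    · exact h0 h1
  · -- `‖d‖ > 1`: the values of `F` decay, so `F = 0`, so `x_{t₀} = 0`
    have hd1 : 1 < ‖d‖ := hgt
    have hdi0 : 0 ≤ ‖d‖⁻¹ := inv_nonneg.mpr (norm_nonneg _)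
    have hdi1 : ‖d‖⁻¹ < 1 := inv_lt_one_of_one_lt₀ hd1
    have hA : ∀ t : ℕ, ‖x t‖ ≤ ‖c‖⁻¹ * ‖d‖⁻¹ ^ t := by
      intro t
      have hxt : x t = c⁻¹ * (d ^ t)⁻¹ * x' t := by
        rw [hrel t]; field_simp
      rw [hxt, norm_mul, norm_mul, norm_inv, norm_inv, norm_pow, ← inv_pow]
      calc ‖c‖⁻¹ * ‖d‖⁻¹ ^ t * ‖x' t‖ ≤ ‖c‖⁻¹ * ‖d‖⁻¹ ^ t * 1 :=
            mul_le_mul_of_nonneg_left (norm_value_le_one (hnode t) (hx' t))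
              (mul_nonneg (inv_nonneg.mpr (norm_nonneg _)) (pow_nonneg hdi0 _))
        _ = ‖c‖⁻¹ * ‖d‖⁻¹ ^ t := mul_one _
    have hF : F = 0 := eq_zero_of_norm_values_le_geometric hu hroot hx hdi0 hdi1 hA
    have hx0 : x t₀ = 0 := by
      have h := hx t₀
      rw [hF] at h
      exact eq_zero_of_hasValueAt_zero_series h
    exact h0 hx0

/-- **Frame shape**: `x'_t = c^{a + b·t} · x_t` for all `t` with `c ≠ 0`, `b > 0` and one `x_{t₀} ≠ 0`
forces `‖c‖ = 1` (`d = c^b`, prefactor `c^a`). [cite: Gouvea1993PadicNumbers, §5.6 (Cor. 5.6.3–5.6.4)] -/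
theorem norm_eq_one_of_values_proportional_pow {F F' : PowerSeries (PadicComplexInt p)} {u c : ℂ_[p]}
    {x x' : ℕ → ℂ_[p]} {a b : ℕ} (hu : ‖u - 1‖ < 1) (hroot : ∀ n : ℕ, 0 < n → u ^ n ≠ 1)
    (hc : c ≠ 0) (hb : 0 < b) (hx : ∀ t : ℕ, IntSeries.HasValueAt F (u ^ t - 1) (x t))
    (hx' : ∀ t : ℕ, IntSeries.HasValueAt F' (u ^ t - 1) (x' t))
    (hrel : ∀ t : ℕ, x' t = c ^ (a + b * t) * x t) {t₀ : ℕ} (h0 : x t₀ ≠ 0) : ‖c‖ = 1 := by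
  have hrel' : ∀ t : ℕ, x' t = c ^ a * (c ^ b) ^ t * x t := by
    intro t; rw [hrel t, ← pow_mul, ← pow_add]
  have hd : ‖c ^ b‖ = 1 :=
    norm_eq_one_of_values_proportional hu hroot (pow_ne_zero _ hc) (pow_ne_zero _ hc) hx hx' hrel' h0
  rw [norm_pow] at hd
  exact (pow_eq_one_iff_of_nonneg (norm_nonneg c) hb.ne').mp hd

/-- **Value norms are invariants**: in the frame shape of `norm_eq_one_of_values_proportional_pow`,
`‖x'_t‖ = ‖x_t‖` for every `t`. [cite: Gouvea1993PadicNumbers, §5.6 (Cor. 5.6.3–5.6.4)] -/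
theorem norm_values_eq_of_proportional_pow {F F' : PowerSeries (PadicComplexInt p)} {u c : ℂ_[p]}
    {x x' : ℕ → ℂ_[p]} {a b : ℕ} (hu : ‖u - 1‖ < 1) (hroot : ∀ n : ℕ, 0 < n → u ^ n ≠ 1)
    (hc : c ≠ 0) (hb : 0 < b) (hx : ∀ t : ℕ, IntSeries.HasValueAt F (u ^ t - 1) (x t))
    (hx' : ∀ t : ℕ, IntSeries.HasValueAt F' (u ^ t - 1) (x' t))
    (hrel : ∀ t : ℕ, x' t = c ^ (a + b * t) * x t) {t₀ : ℕ} (h0 : x t₀ ≠ 0) (t : ℕ) :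
    ‖x' t‖ = ‖x t‖ := by
  have hc1 : ‖c‖ = 1 := norm_eq_one_of_values_proportional_pow hu hroot hc hb hx hx' hrel h0
  rw [hrel t, norm_mul, norm_pow, hc1, one_pow, one_mul]

/-! ### §5. The node hypothesis from the frames: no root of unity among the one-units of level `|p|` -/

/-- **`u ≠ 1` with `‖u − 1‖ < ‖p‖` is not a root of unity** (read in `ℂ_p`): for `n = p^k·m`, `p ∤ m`,
`‖(u^{p^k})ᵐ − 1‖ = ‖u^{p^k} − 1‖` and `‖uᵖ − 1‖ = ‖p‖·‖u − 1‖` peel off the factors.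
[cite: Gouvea1993PadicNumbers, §5.6] -/
theorem forall_pow_ne_one_of_norm_sub_one_lt {u : ℂ_[p]} (hu1 : u ≠ 1)
    (hup : ‖u - 1‖ < ‖(p : ℂ_[p])‖) : ∀ n : ℕ, 0 < n → u ^ n ≠ 1 := by
  have hp1 : ‖(p : ℂ_[p])‖ ≤ 1 := norm_natCast_prime_lt_one.le
  have hp0 : 0 < ‖(p : ℂ_[p])‖ := by
    rw [← PadicComplex.coe_natCast p p, PadicComplex.norm_extends p,
      Literature.NumberTheory.GaloisRepresentations.PadicAlgCl.norm_natCast_self]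
    exact inv_pos.mpr (by exact_mod_cast (Fact.out : p.Prime).pos)
  -- general statement by induction on the `p`-part, for all `u` of level `< |p|`
  suffices key : ∀ (k : ℕ) (w : ℂ_[p]), ‖w - 1‖ < ‖(p : ℂ_[p])‖ → ∀ m : ℕ, ¬ p ∣ m →
      w ^ (p ^ k * m) = 1 → w = 1 by
    intro n hn h
    obtain ⟨k, m, hm, rfl⟩ := Nat.exists_eq_pow_mul_and_not_dvd hn.ne' p (Fact.out : p.Prime).ne_one
    exact hu1 (key k u hup m hm h)
  intro k
  induction k with
  | zero =>
    intro w hw m hm h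
    rw [pow_zero, one_mul] at h
    have hw1 : ‖w - 1‖ < 1 := hw.trans_le hp1
    have hmn : ‖(m : ℂ_[p])‖ = 1 := by
      rw [← PadicComplex.coe_natCast p m, PadicComplex.norm_extends p]
      exact Literature.NumberTheory.GaloisRepresentations.PadicAlgCl.norm_natCast_eq_one_of_not_dvd hm
    have := Literature.NumberTheory.GaloisRepresentations.norm_pow_sub_one_of_norm_natCast_eq_one hw1 hmn
    rw [h, sub_self, norm_zero] at this
    exact sub_eq_zero.mp (norm_eq_zero.mp this.symm)
  | succ k ih =>
    intro w hw m hm h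
    -- `w^p` is again of level `< |p|`, indeed `‖w^p − 1‖ = ‖p‖‖w − 1‖`
    have hwp : ‖w ^ p - 1‖ = ‖(p : ℂ_[p])‖ * ‖w - 1‖ :=
      Literature.NumberTheory.GaloisRepresentations.norm_pow_sub_one_of_norm_sub_one_lt_norm hp1 hw
    have hwp' : ‖w ^ p - 1‖ < ‖(p : ℂ_[p])‖ := by
      rw [hwp]
      calc ‖(p : ℂ_[p])‖ * ‖w - 1‖ ≤ ‖(p : ℂ_[p])‖ * ‖(p : ℂ_[p])‖ :=
            mul_le_mul_of_nonneg_left hw.le (norm_nonneg _)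
        _ < ‖(p : ℂ_[p])‖ * 1 := mul_lt_mul_of_pos_left (norm_natCast_prime_lt_one) hp0
        _ = ‖(p : ℂ_[p])‖ := mul_one _
    have h' : (w ^ p) ^ (p ^ k * m) = 1 := by
      rw [← pow_mul]
      have : p * (p ^ k * m) = p ^ (k + 1) * m := by ring
      rw [this]; exact h
    have hwp1 : w ^ p = 1 := ih (w ^ p) hwp' m hm h'
    rw [hwp1, sub_self, norm_zero] at hwp
    have : ‖w - 1‖ = 0 := by
      rcases mul_eq_zero.mp hwp.symm with h1 | h1
      · exact absurd h1 hp0.ne'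
      · exact h1
    exact sub_eq_zero.mp (norm_eq_zero.mp this)

end Literature.NumberTheory.EllipticCurves.IntSeries
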